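import Literature.NumberTheory.Rogawski1990.CharIdentityOnTestFunctionsLemmas
import HarnessLib

/-!
# The character identities [Rogawski1990, 13.1.4] on test functions, SIGNED — `χ_ξ(f^H) = ε_v · Σ_{π ∈ Π(ξ_v)} χ_π(f)` for the tree's
# transfer factor of record `Δ‴_v = ε_v(H) · Δ_v^{print}` (`ε_v(H) = ω_w(−det H) ∈ {±1}`)

Topic `NumberTheory/Rogawski1990`; namespace `Literature.NumberTheory.Rogawski1990`.  DEFINITIONS WITH BODY (`Prop`-valued predicates on GIVEN data) + their
`Iff.rfl` unfoldings + two one-line comparison lemmas (`ε = 1` is the unsigned letter; the explicit-sum reading); no named fact (net debt 0), no instance, no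
notation, no attribute, no `sorry`; ★ `CharIdentityOnTestFunctions` is NOT edited (supersede-not-edit).  This file ASSERTS NOTHING.  Cell `pub/hodgecm-mathlib`
(D-0151), crux H413 = `stmt-HodgeConjecture-24833`; desk F0P3b-plan (g12) word 2026-09-01T08:26:21Z «K2 — (QS-DEF)» executing LEAD F0P3a-plan (g10) WORD T9-5
RULING «K» (K1: the normalisation of record stays; K2: the character-identity letters are re-typed SIGNED); typist A-p16 (g27).

WHY.  The tree's finite transfer factor of record is ★ `finExplicitCollection` (absolute Hilbert-symbol `κ_v`, read on any `u`-eigenvector by the unit-norm test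
★ `finKappaAt_eq_ite_of_eigenvector`: `κ_v = if (∃ z unit, x₀ = z·σ z) then 1 else −1`), paired with the η-FREE archimedean factor ★ `archCanonicalTransferFactor` so
that the PRODUCT FORMULA holds on the nose (★ `SatisfiesProductFormula`; print's `Δ″` satisfies it only up to `c = ±1`, [Rogawski1990 §14.6 p. 242]).  Consequently, at a
finite NON-SPLIT `v`, in the frame `ᵗσT · H_v · T = a · Φ₃` (`a` a unit of `L⁺_v`) the tree's factor is `Δ‴_v = ε_v(H) · (print's Δ_v ∘ frame)` with the SIGN
`ε_v(H) = ω_{L_w∕L⁺_v}(a) = (if ∃ z unit, a = z·σ z then 1 else −1)` (F0P3b-p01 (g7) census c1cd5fbb «κ-SIGN», S3-B ★ `FinExplicitTransferFactorLeviStratumFrame`).  Print's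
identity [13.1.4] `χ_ξ(f^H) = Σ_{π ∈ Π(ξ_v)} χ_π(f)` holds for pairs matched by PRINT's `Δ_v`; a pair `(f^H, f)` matched by `Δ‴_v` is a pair `(ε_v f^H, f)` matched by
`Δ_v`, so for `Δ‴_v`-matched TEST pairs the identity reads **`χ_ξ(f^H) = ε_v · (χ_{πⁿ}(f) + χ_{πˢ}(f))`**.  ★ `LocalAPacket.CharIdentityAtTest` carries the member traces as a
PARAMETER `tr`, so the sign rides on `tr := fun c f => ε * c.smoothTrace μG f` and NO generic layer is duplicated.
* §1 **`CMNonsplitCharIdentityAtTestSigned L v H′ T mH mG μG μH ξv ε πn`** — ★ `CMNonsplitCharIdentityAtTest` :159 with one extra binder `(ε : ℂ)` before `πn`; `_iff`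
  (`Iff.rfl`); the explicit-sum reading `… ↔ ∃ πs, … ∧ ∀ fH f, … → charDist ξv μH fH = ε * (πⁿ.smoothTrace μG f + πˢ.smoothTrace μG f)`; `ε = 1` ⇔ the unsigned letter.
* §2 **`CMCharIdentityClausesTestSigned`** — ★ `CMCharIdentityClausesTest` :355 TEXT VERBATIM except that the non-split conjunct's predicate is the SIGNED one at
  `ε := if ∃ z : LocalRing L v, IsUnit z ∧ a = z * conjLocal L c v z then 1 else −1` (the frame's `a` is already bound there; split conjunct verbatim, `ε = 1` at split
  `v` where `Δ‴_v` IS print's factor); **`CMCharIdentityPackageTestSigned`** — ★ `CMCharIdentityPackageTest` :391 verbatim over it (the TYPE of the re-typed `hQ` binder of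
  the closer's `stub_QCMT` ∕ `stub_K9STF` in the «QCMT SIGNED» edition and of P3b ED. 13's head pin); `_iff` ×2 (`Iff.rfl`).
HONEST SCOPE.  Definitions and one-line logic; HC_CM is proved only modulo the printed citations (the 2 remaining named inputs hLiu418, h413) until rung 0
closes; this file proves no printed statement.

## References
* [Rogawski1990] J. D. Rogawski, *Automorphic Representations of Unitary Groups in Three Variables*, Ann. of Math. Studies 123 (1990): §13.1 Prop. 13.1.4 p. 199
  (the identity), §4.9 p. 55 (the local transfer and its factor), §14.6 p. 242 (the product formula up to `c`), §4.13 Lemma 4.13.1 (b) p. 63, §13.3 p. 201.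
* [LanglandsShelstad1987] R. P. Langlands, D. Shelstad, *On the definition of transfer factors*, Math. Ann. 278 (1987): §1 (the `κ`-sign on `inv`), §6 (product
  formula).
-/

noncomputable section

open MeasureTheory NumberField IsDedekindDomain Topology
open scoped Matrix MatrixGroups ComplexOrder

namespace Literature.NumberTheory.Rogawski1990

open Literature.NumberTheory.Automorphic Literature.NumberTheory.Automorphic.UnitaryGroup
open Literature.NumberTheory.Automorphic.UnitaryGroup.CotangentForms Literature.NumberTheory.GaloisRepresentations
open Literature.NumberTheory.Automorphic.Arthur2013.Leaves.TECR

/-! ## §1 [13.1.4] at a NON-SPLIT finite place, on given data, on test functions, SIGNED -/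

section CM

variable (L : Type) [Field L] [NumberField L] [IsCMField L]
  (v : HeightOneSpectrum (𝓞 ↥(maximalRealSubfield L)))

variable (H' : Matrix (Fin 3) (Fin 3) L)

variable
    [MeasurableSpace ((UnitaryGroup.cmDatum L 3 H').Local v)]
    [MeasurableSpace ((UnitaryGroup.cmDatum L 2 (Matrix.of fun i j : Fin 2 => if i.val + j.val + 1 = 2 then (1 : L) else 0)).Local v ×
      (UnitaryGroup.cmDatum L 1 (Matrix.of fun i j : Fin 1 => if i.val + j.val + 1 = 1 then (1 : L) else 0)).Local v)]
    [∀ a : ((UnitaryGroup.cmDatum L 2 (Matrix.of fun i j : Fin 2 => if i.val + j.val + 1 = 2 then (1 : L) else 0)).Local v ×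
        (UnitaryGroup.cmDatum L 1 (Matrix.of fun i j : Fin 1 => if i.val + j.val + 1 = 1 then (1 : L) else 0)).Local v),
      MeasurableSpace (((UnitaryGroup.cmDatum L 2 (Matrix.of fun i j : Fin 2 => if i.val + j.val + 1 = 2 then (1 : L) else 0)).Local v ×
        (UnitaryGroup.cmDatum L 1 (Matrix.of fun i j : Fin 1 => if i.val + j.val + 1 = 1 then (1 : L) else 0)).Local v) ⧸
        Subgroup.centralizer ({a} : Set ((UnitaryGroup.cmDatum L 2 (Matrix.of fun i j : Fin 2 => if i.val + j.val + 1 = 2 then (1 : L) else 0)).Local v ×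
        (UnitaryGroup.cmDatum L 1 (Matrix.of fun i j : Fin 1 => if i.val + j.val + 1 = 1 then (1 : L) else 0)).Local v)))]
    [∀ γ : (UnitaryGroup.cmDatum L 3 H').Local v,
      MeasurableSpace ((UnitaryGroup.cmDatum L 3 H').Local v ⧸ Subgroup.centralizer ({γ} : Set ((UnitaryGroup.cmDatum L 3 H').Local v)))]

/-- **[13.1.4] at a NON-SPLIT finite place, on given data, on TEST functions, SIGNED by `ε ∈ ℂ`** (★ `CMNonsplitCharIdentityAtTest` with one extra binder `(ε : ℂ)`
before `πn`; the sign rides on the member-trace parameter `tr := fun c f => ε * Tr c(f dμ_G)` of ★ `LocalAPacket.CharIdentityAtTest`): there is a SUPERCUSPIDAL class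
`πˢ ≠ πⁿ` [13.1.3 (d)] with `∫ ξ_v f^H_v dμ_H = ε · (Tr πⁿ(f_v dμ_G) + Tr πˢ(f_v dμ_G))` for every `Δ_v`-matching pair of TEST functions.  Intended reading: `Δ_v` the
tree's `Δ‴_v = ε_v(H)·Δ_v^{print}` and `ε = ε_v(H) = ω_w(−det H) ∈ {±1}`.  A PREDICATE.
[cite: Rogawski1990, §13.1 Prop. 13.1.3 (d), Prop. 13.1.4 p. 199; §4.9 p. 55; §14.6 p. 242] [cite: LanglandsShelstad1987, §1] -/
def CMNonsplitCharIdentityAtTestSigned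
    (T : LocalTransferFactor L H' v)
    (mH : OrbitalMeasureFamily ((UnitaryGroup.cmDatum L 2 (Matrix.of fun i j : Fin 2 => if i.val + j.val + 1 = 2 then (1 : L) else 0)).Local v ×
        (UnitaryGroup.cmDatum L 1 (Matrix.of fun i j : Fin 1 => if i.val + j.val + 1 = 1 then (1 : L) else 0)).Local v))
    (mG : OrbitalMeasureFamily ((UnitaryGroup.cmDatum L 3 H').Local v)) (μG : Measure ((UnitaryGroup.cmDatum L 3 H').Local v))
    (μH : Measure ((UnitaryGroup.cmDatum L 2 (Matrix.of fun i j : Fin 2 => if i.val + j.val + 1 = 2 then (1 : L) else 0)).Local v ×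
        (UnitaryGroup.cmDatum L 1 (Matrix.of fun i j : Fin 1 => if i.val + j.val + 1 = 1 then (1 : L) else 0)).Local v))
    (ξv : (UnitaryGroup.cmDatum L 2 (Matrix.of fun i j : Fin 2 => if i.val + j.val + 1 = 2 then (1 : L) else 0)).Local v ×
        (UnitaryGroup.cmDatum L 1 (Matrix.of fun i j : Fin 1 => if i.val + j.val + 1 = 1 then (1 : L) else 0)).Local v →* ℂˣ)
    (ε : ℂ) (πn : IrrClass ((UnitaryGroup.cmDatum L 3 H').Local v)) : Prop :=
  ∃ πs : IrrClass ((UnitaryGroup.cmDatum L 3 H').Local v), πs.IsSupercuspidal ∧ πs ≠ πn ∧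
    (⟨πn, some πs⟩ : CMLocalAPacket L H' v).CharIdentityAtTest L H' v (fun c f => ε * c.smoothTrace μG f) ξv μH T mH mG

/-- Unfolding of `CMNonsplitCharIdentityAtTestSigned`, token for token. [cite: Rogawski1990, §13.1 Prop. 13.1.4 p. 199] -/
theorem cmNonsplitCharIdentityAtTestSigned_iff
    (T : LocalTransferFactor L H' v)
    (mH : OrbitalMeasureFamily ((UnitaryGroup.cmDatum L 2 (Matrix.of fun i j : Fin 2 => if i.val + j.val + 1 = 2 then (1 : L) else 0)).Local v ×
        (UnitaryGroup.cmDatum L 1 (Matrix.of fun i j : Fin 1 => if i.val + j.val + 1 = 1 then (1 : L) else 0)).Local v))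
    (mG : OrbitalMeasureFamily ((UnitaryGroup.cmDatum L 3 H').Local v)) (μG : Measure ((UnitaryGroup.cmDatum L 3 H').Local v))
    (μH : Measure ((UnitaryGroup.cmDatum L 2 (Matrix.of fun i j : Fin 2 => if i.val + j.val + 1 = 2 then (1 : L) else 0)).Local v ×
        (UnitaryGroup.cmDatum L 1 (Matrix.of fun i j : Fin 1 => if i.val + j.val + 1 = 1 then (1 : L) else 0)).Local v))
    (ξv : (UnitaryGroup.cmDatum L 2 (Matrix.of fun i j : Fin 2 => if i.val + j.val + 1 = 2 then (1 : L) else 0)).Local v ×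
        (UnitaryGroup.cmDatum L 1 (Matrix.of fun i j : Fin 1 => if i.val + j.val + 1 = 1 then (1 : L) else 0)).Local v →* ℂˣ)
    (ε : ℂ) (πn : IrrClass ((UnitaryGroup.cmDatum L 3 H').Local v)) :
    CMNonsplitCharIdentityAtTestSigned L v H' T mH mG μG μH ξv ε πn ↔
      ∃ πs : IrrClass ((UnitaryGroup.cmDatum L 3 H').Local v), πs.IsSupercuspidal ∧ πs ≠ πn ∧
        (⟨πn, some πs⟩ : CMLocalAPacket L H' v).CharIdentityAtTest L H' v (fun c f => ε * c.smoothTrace μG f) ξv μH T mH mG :=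
  Iff.rfl

/-- **The explicit-sum reading of the signed non-split letter**: `∃ πˢ` supercuspidal, `πˢ ≠ πⁿ`, with
`∫ ξ_v f^H dμ_H = ε · (Tr πⁿ(f dμ_G) + Tr πˢ(f dμ_G))` for every `Δ_v`-matching pair of TEST functions (★ `charIdentityAtTest_pair_iff` + `mul_add`).
[cite: Rogawski1990, §13.1 Prop. 13.1.4 p. 199; §12.3 Prop. 12.3.3 (a) p. 178] -/
theorem cmNonsplitCharIdentityAtTestSigned_iff_exists_forall
    (T : LocalTransferFactor L H' v)
    (mH : OrbitalMeasureFamily ((UnitaryGroup.cmDatum L 2 (Matrix.of fun i j : Fin 2 => if i.val + j.val + 1 = 2 then (1 : L) else 0)).Local v ×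
        (UnitaryGroup.cmDatum L 1 (Matrix.of fun i j : Fin 1 => if i.val + j.val + 1 = 1 then (1 : L) else 0)).Local v))
    (mG : OrbitalMeasureFamily ((UnitaryGroup.cmDatum L 3 H').Local v)) (μG : Measure ((UnitaryGroup.cmDatum L 3 H').Local v))
    (μH : Measure ((UnitaryGroup.cmDatum L 2 (Matrix.of fun i j : Fin 2 => if i.val + j.val + 1 = 2 then (1 : L) else 0)).Local v ×
        (UnitaryGroup.cmDatum L 1 (Matrix.of fun i j : Fin 1 => if i.val + j.val + 1 = 1 then (1 : L) else 0)).Local v))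
    (ξv : (UnitaryGroup.cmDatum L 2 (Matrix.of fun i j : Fin 2 => if i.val + j.val + 1 = 2 then (1 : L) else 0)).Local v ×
        (UnitaryGroup.cmDatum L 1 (Matrix.of fun i j : Fin 1 => if i.val + j.val + 1 = 1 then (1 : L) else 0)).Local v →* ℂˣ)
    (ε : ℂ) (πn : IrrClass ((UnitaryGroup.cmDatum L 3 H').Local v)) :
    CMNonsplitCharIdentityAtTestSigned L v H' T mH mG μG μH ξv ε πn ↔
      ∃ πs : IrrClass ((UnitaryGroup.cmDatum L 3 H').Local v), πs.IsSupercuspidal ∧ πs ≠ πn ∧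
        ∀ fH f, IsLocSmooth fH → IsLocSmooth f → IsLocalDeltaTransfer L H' v T mH mG fH f →
          charDist ξv μH fH = ε * (πn.smoothTrace μG f + πs.smoothTrace μG f) := by
  refine exists_congr fun πs => and_congr_right fun _ => and_congr_right fun _ => ?_
  rw [LocalAPacket.charIdentityAtTest_pair_iff]
  simp only [mul_add]

/-- **`ε = 1` is the unsigned letter**: `CMNonsplitCharIdentityAtTestSigned … 1 πⁿ ↔ CMNonsplitCharIdentityAtTest … πⁿ` (`one_mul`).
[cite: Rogawski1990, §13.1 Prop. 13.1.4 p. 199] -/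
theorem cmNonsplitCharIdentityAtTestSigned_one_iff
    (T : LocalTransferFactor L H' v)
    (mH : OrbitalMeasureFamily ((UnitaryGroup.cmDatum L 2 (Matrix.of fun i j : Fin 2 => if i.val + j.val + 1 = 2 then (1 : L) else 0)).Local v ×
        (UnitaryGroup.cmDatum L 1 (Matrix.of fun i j : Fin 1 => if i.val + j.val + 1 = 1 then (1 : L) else 0)).Local v))
    (mG : OrbitalMeasureFamily ((UnitaryGroup.cmDatum L 3 H').Local v)) (μG : Measure ((UnitaryGroup.cmDatum L 3 H').Local v))
    (μH : Measure ((UnitaryGroup.cmDatum L 2 (Matrix.of fun i j : Fin 2 => if i.val + j.val + 1 = 2 then (1 : L) else 0)).Local v ×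
        (UnitaryGroup.cmDatum L 1 (Matrix.of fun i j : Fin 1 => if i.val + j.val + 1 = 1 then (1 : L) else 0)).Local v))
    (ξv : (UnitaryGroup.cmDatum L 2 (Matrix.of fun i j : Fin 2 => if i.val + j.val + 1 = 2 then (1 : L) else 0)).Local v ×
        (UnitaryGroup.cmDatum L 1 (Matrix.of fun i j : Fin 1 => if i.val + j.val + 1 = 1 then (1 : L) else 0)).Local v →* ℂˣ)
    (πn : IrrClass ((UnitaryGroup.cmDatum L 3 H').Local v)) :
    CMNonsplitCharIdentityAtTestSigned L v H' T mH mG μG μH ξv 1 πn ↔ CMNonsplitCharIdentityAtTest L v H' T mH mG μG μH ξv πn := by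
  simp only [CMNonsplitCharIdentityAtTestSigned, CMNonsplitCharIdentityAtTest, one_mul]

end CM

/-! ## §2 The CM character-identity clauses and package of the joint letter, on test functions, SIGNED at the non-split places -/

section Clauses

variable (L : Type) [Field L] [NumberField L] [IsCMField L] (H : Matrix (Fin 3) (Fin 3) L)
  (hH : (H.map (cmConjRingHom L))ᵀ = H) (hHd : IsUnit H.det)

variable
    [∀ v : HeightOneSpectrum (𝓞 ↥(maximalRealSubfield L)), MeasurableSpace ((cmDatum L 3 H).Local v)]
    [∀ v : HeightOneSpectrum (𝓞 ↥(maximalRealSubfield L)),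
      MeasurableSpace ((cmDatum L 2 (Matrix.of fun i j : Fin 2 => if i.val + j.val + 1 = 2 then (1 : L) else 0)).Local v ×
        (cmDatum L 1 (Matrix.of fun i j : Fin 1 => if i.val + j.val + 1 = 1 then (1 : L) else 0)).Local v)]
    [∀ (v : HeightOneSpectrum (𝓞 ↥(maximalRealSubfield L)))
        (a : ((cmDatum L 2 (Matrix.of fun i j : Fin 2 => if i.val + j.val + 1 = 2 then (1 : L) else 0)).Local v ×
          (cmDatum L 1 (Matrix.of fun i j : Fin 1 => if i.val + j.val + 1 = 1 then (1 : L) else 0)).Local v)),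
      MeasurableSpace (((cmDatum L 2 (Matrix.of fun i j : Fin 2 => if i.val + j.val + 1 = 2 then (1 : L) else 0)).Local v ×
          (cmDatum L 1 (Matrix.of fun i j : Fin 1 => if i.val + j.val + 1 = 1 then (1 : L) else 0)).Local v) ⧸
        Subgroup.centralizer ({a} : Set ((cmDatum L 2 (Matrix.of fun i j : Fin 2 => if i.val + j.val + 1 = 2 then (1 : L) else 0)).Local v ×
          (cmDatum L 1 (Matrix.of fun i j : Fin 1 => if i.val + j.val + 1 = 1 then (1 : L) else 0)).Local v)))]
    [∀ (v : HeightOneSpectrum (𝓞 ↥(maximalRealSubfield L))) (γ : (cmDatum L 3 H).Local v),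
      MeasurableSpace ((cmDatum L 3 H).Local v ⧸ Subgroup.centralizer ({γ} : Set ((cmDatum L 3 H).Local v)))]

open scoped Classical in
/-- **The CM character-identity clauses of the joint letter, on TEST functions, SIGNED** (★ `CMCharIdentityClausesTest` :355 TEXT VERBATIM — the non-split binder block
`v hns T a ha h μZ π2 πn hK hn` and the split instantiation at `splitWitness v hs`, `ξ.splitν₀ μω`, `ξ.locψ` BYTE-IDENTICAL — except that the non-split conjunct concludes the
SIGNED predicate ★ `CMNonsplitCharIdentityAtTestSigned` at `ε_v(H) := if ∃ z : L_w, IsUnit z ∧ a = z·σ(z) then 1 else −1`, the quadratic character `ω_{L_w∕L⁺_v}` of the frame's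
multiplier `a` (`ᵗσT·H_v·T = a·Φ₃`), i.e. the sign by which the tree's `Δ‴_v` differs from print's `Δ_v` transported by the frame (★ `finKappaAt_eq_ite_of_eigenvector`'s unit-norm
test); at a SPLIT `v` the tree's factor IS print's and the conjunct is ★ `CMSplitCharIdentityAtTest` verbatim (`ε = 1`).
[cite: Rogawski1990, §13.1 Prop. 13.1.3 (d), Prop. 13.1.4 p. 199; §4.9 p. 55; §14.6 p. 242; §12.2 p. 174; §4.13 Lemma 4.13.1 (b) p. 63; §13.3 p. 201] [cite: LanglandsShelstad1987, §1] -/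
def CMCharIdentityClausesTestSigned
    (Δ : ∀ v : HeightOneSpectrum (𝓞 ↥(maximalRealSubfield L)), LocalTransferFactor L H v)
    (mH : ∀ v : HeightOneSpectrum (𝓞 ↥(maximalRealSubfield L)),
      OrbitalMeasureFamily ((cmDatum L 2 (Matrix.of fun i j : Fin 2 => if i.val + j.val + 1 = 2 then (1 : L) else 0)).Local v ×
        (cmDatum L 1 (Matrix.of fun i j : Fin 1 => if i.val + j.val + 1 = 1 then (1 : L) else 0)).Local v))
    (mG : ∀ v : HeightOneSpectrum (𝓞 ↥(maximalRealSubfield L)), OrbitalMeasureFamily ((cmDatum L 3 H).Local v))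
    (νH : ∀ v : HeightOneSpectrum (𝓞 ↥(maximalRealSubfield L)),
      Measure ((cmDatum L 2 (Matrix.of fun i j : Fin 2 => if i.val + j.val + 1 = 2 then (1 : L) else 0)).Local v ×
        (cmDatum L 1 (Matrix.of fun i j : Fin 1 => if i.val + j.val + 1 = 1 then (1 : L) else 0)).Local v))
    (νG : ∀ v : HeightOneSpectrum (𝓞 ↥(maximalRealSubfield L)), Measure ((cmDatum L 3 H).Local v))
    (ξ : OneDimAutRepH L) (μω : HeckeCharacter L) (hμu : μω.IsUnitary)
    (ξloc : ∀ v : HeightOneSpectrum (𝓞 ↥(maximalRealSubfield L)),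
      (cmDatum L 2 (Matrix.of fun i j : Fin 2 => if i.val + j.val + 1 = 2 then (1 : L) else 0)).Local v ×
        (cmDatum L 1 (Matrix.of fun i j : Fin 1 => if i.val + j.val + 1 = 1 then (1 : L) else 0)).Local v →* ℂˣ) : Prop :=
  (∀ (v : HeightOneSpectrum (𝓞 ↥(maximalRealSubfield L))),
      (∀ w : PlacesOver L v, IsCMField.complexConj L • w.1 = w.1) →
      ∀ (T : GL (Fin 3) (LocalRing L v)) (a : LocalRing L v) (ha : IsUnit a)
        (h : formCongr (conjLocal L (IsCMField.complexConj L) v) T (H.map (algebraMap L (LocalRing L v))) =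
          a • (Matrix.of fun i j : Fin 3 => if i.val + j.val + 1 = 3 then (1 : L) else 0).map (algebraMap L (LocalRing L v))),
      ∀ [MeasurableSpace (Gqs L v ⧸ Subgroup.center (Gqs L v))] [BorelSpace (Gqs L v ⧸ Subgroup.center (Gqs L v))]
        (μZ : Measure (Gqs L v ⧸ Subgroup.center (Gqs L v))) [μZ.IsHaarMeasure],
      ∀ (π2 πn : IrrClass (Gqs L v)),
        KeysCaseTwoLabels L v (μω.semilocalComponent L v) (torusLocalComponent L (IsCMField.complexConj L) v ξ.η)
          (torusLocalComponent L (IsCMField.complexConj L) v ξ.ψ) π2 πn →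
        ¬ πn.IsSquareIntegrable μZ →
        CMNonsplitCharIdentityAtTestSigned L v H (Δ v) (mH v) (mG v) (νG v) (νH v) (ξloc v)
          (if ∃ z : LocalRing L v, IsUnit z ∧ a = z * conjLocal L (IsCMField.complexConj L) v z then (1 : ℂ) else -1)
          (IrrClass.comap (cmDatumLocalCongr L v T ha h).symm πn)) ∧
  (∀ (v : HeightOneSpectrum (𝓞 ↥(maximalRealSubfield L))) (hs : ∃ w : PlacesOver L v, IsCMField.complexConj L • w.1 ≠ w.1),
      CMSplitCharIdentityAtTest L v H hH hHd (splitWitness v hs) (splitWitness_spec v hs) (ξ.splitν₀ μω (splitWitness v hs).1)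
        (ξ.locψ (splitWitness v hs).1) (ξ.norm_splitν₀_apply hμu (splitWitness v hs).1)
        (ξ.continuous_splitν₀ μω (splitWitness v hs).1) (ξ.norm_locψ_apply (splitWitness v hs).1)
        (ξ.continuous_locψ (splitWitness v hs).1) (Δ v) (mH v) (mG v) (νG v) (νH v) (ξloc v))

/-- **`Q_CM` on TEST functions, SIGNED — the re-typed CM character-identity package** (★ `CMCharIdentityPackageTest` :391 verbatim over the signed clauses; the TYPE of
the `hQ` binder of the closer's `stub_QCMT` ∕ `stub_K9STF` in the «QCMT SIGNED» edition): for the global data `(Δ_v, m_{H,v}, m_{G,v})_v`, the clauses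
`CMCharIdentityClausesTestSigned` for EVERY global character `ξ` of `H`, at the local characters `ξ_v = ξ.xiLocalChar v` BY NAME.
[cite: Rogawski1990, §13.1 Prop. 13.1.4 p. 199; §4.13 Lemma 4.13.1 (b) p. 63; §13.3 p. 202; §14.6 p. 242] [cite: LanglandsShelstad1987, §1] -/
def CMCharIdentityPackageTestSigned
    (νH : ∀ v : HeightOneSpectrum (𝓞 ↥(maximalRealSubfield L)),
      Measure ((cmDatum L 2 (Matrix.of fun i j : Fin 2 => if i.val + j.val + 1 = 2 then (1 : L) else 0)).Local v ×
        (cmDatum L 1 (Matrix.of fun i j : Fin 1 => if i.val + j.val + 1 = 1 then (1 : L) else 0)).Local v))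
    (νG : ∀ v : HeightOneSpectrum (𝓞 ↥(maximalRealSubfield L)), Measure ((cmDatum L 3 H).Local v))
    (μω : HeckeCharacter L) (hμu : μω.IsUnitary) :
    (∀ v : HeightOneSpectrum (𝓞 ↥(maximalRealSubfield L)), LocalTransferFactor L H v) →
    (∀ v : HeightOneSpectrum (𝓞 ↥(maximalRealSubfield L)),
      OrbitalMeasureFamily ((cmDatum L 2 (Matrix.of fun i j : Fin 2 => if i.val + j.val + 1 = 2 then (1 : L) else 0)).Local v ×
        (cmDatum L 1 (Matrix.of fun i j : Fin 1 => if i.val + j.val + 1 = 1 then (1 : L) else 0)).Local v)) →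
    (∀ v : HeightOneSpectrum (𝓞 ↥(maximalRealSubfield L)), OrbitalMeasureFamily ((cmDatum L 3 H).Local v)) → Prop :=
  fun Δ mH mG => ∀ ξ : OneDimAutRepH L, CMCharIdentityClausesTestSigned L H hH hHd Δ mH mG νH νG ξ μω hμu (fun v => ξ.xiLocalChar v)

variable {L H hH hHd}
variable
  {Δ : ∀ v : HeightOneSpectrum (𝓞 ↥(maximalRealSubfield L)), LocalTransferFactor L H v}
  {mH : ∀ v : HeightOneSpectrum (𝓞 ↥(maximalRealSubfield L)),
    OrbitalMeasureFamily ((cmDatum L 2 (Matrix.of fun i j : Fin 2 => if i.val + j.val + 1 = 2 then (1 : L) else 0)).Local v ×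
      (cmDatum L 1 (Matrix.of fun i j : Fin 1 => if i.val + j.val + 1 = 1 then (1 : L) else 0)).Local v)}
  {mG : ∀ v : HeightOneSpectrum (𝓞 ↥(maximalRealSubfield L)), OrbitalMeasureFamily ((cmDatum L 3 H).Local v)}
  {νH : ∀ v : HeightOneSpectrum (𝓞 ↥(maximalRealSubfield L)),
    Measure ((cmDatum L 2 (Matrix.of fun i j : Fin 2 => if i.val + j.val + 1 = 2 then (1 : L) else 0)).Local v ×
      (cmDatum L 1 (Matrix.of fun i j : Fin 1 => if i.val + j.val + 1 = 1 then (1 : L) else 0)).Local v)}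
  {νG : ∀ v : HeightOneSpectrum (𝓞 ↥(maximalRealSubfield L)), Measure ((cmDatum L 3 H).Local v)}
  {ξ : OneDimAutRepH L} {μω : HeckeCharacter L} {hμu : μω.IsUnitary}
  {ξloc : ∀ v : HeightOneSpectrum (𝓞 ↥(maximalRealSubfield L)),
    (cmDatum L 2 (Matrix.of fun i j : Fin 2 => if i.val + j.val + 1 = 2 then (1 : L) else 0)).Local v ×
      (cmDatum L 1 (Matrix.of fun i j : Fin 1 => if i.val + j.val + 1 = 1 then (1 : L) else 0)).Local v →* ℂˣ}

open scoped Classical in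
/-- Unfolding of `CMCharIdentityClausesTestSigned`, token for token. [cite: Rogawski1990, §13.1 Prop. 13.1.4 p. 199; §4.13 Lemma 4.13.1 (b) p. 63; §14.6 p. 242] -/
theorem cmCharIdentityClausesTestSigned_iff :
    CMCharIdentityClausesTestSigned L H hH hHd Δ mH mG νH νG ξ μω hμu ξloc ↔
      (∀ (v : HeightOneSpectrum (𝓞 ↥(maximalRealSubfield L))),
          (∀ w : PlacesOver L v, IsCMField.complexConj L • w.1 = w.1) →
          ∀ (T : GL (Fin 3) (LocalRing L v)) (a : LocalRing L v) (ha : IsUnit a)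
            (h : formCongr (conjLocal L (IsCMField.complexConj L) v) T (H.map (algebraMap L (LocalRing L v))) =
              a • (Matrix.of fun i j : Fin 3 => if i.val + j.val + 1 = 3 then (1 : L) else 0).map (algebraMap L (LocalRing L v))),
          ∀ [MeasurableSpace (Gqs L v ⧸ Subgroup.center (Gqs L v))] [BorelSpace (Gqs L v ⧸ Subgroup.center (Gqs L v))]
            (μZ : Measure (Gqs L v ⧸ Subgroup.center (Gqs L v))) [μZ.IsHaarMeasure],
          ∀ (π2 πn : IrrClass (Gqs L v)),
            KeysCaseTwoLabels L v (μω.semilocalComponent L v) (torusLocalComponent L (IsCMField.complexConj L) v ξ.η)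
              (torusLocalComponent L (IsCMField.complexConj L) v ξ.ψ) π2 πn →
            ¬ πn.IsSquareIntegrable μZ →
            CMNonsplitCharIdentityAtTestSigned L v H (Δ v) (mH v) (mG v) (νG v) (νH v) (ξloc v)
              (if ∃ z : LocalRing L v, IsUnit z ∧ a = z * conjLocal L (IsCMField.complexConj L) v z then (1 : ℂ) else -1)
              (IrrClass.comap (cmDatumLocalCongr L v T ha h).symm πn)) ∧
      (∀ (v : HeightOneSpectrum (𝓞 ↥(maximalRealSubfield L))) (hs : ∃ w : PlacesOver L v, IsCMField.complexConj L • w.1 ≠ w.1),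
          CMSplitCharIdentityAtTest L v H hH hHd (splitWitness v hs) (splitWitness_spec v hs) (ξ.splitν₀ μω (splitWitness v hs).1)
            (ξ.locψ (splitWitness v hs).1) (ξ.norm_splitν₀_apply hμu (splitWitness v hs).1)
            (ξ.continuous_splitν₀ μω (splitWitness v hs).1) (ξ.norm_locψ_apply (splitWitness v hs).1)
            (ξ.continuous_locψ (splitWitness v hs).1) (Δ v) (mH v) (mG v) (νG v) (νH v) (ξloc v)) :=
  Iff.rfl

/-- Unfolding of `CMCharIdentityPackageTestSigned` (`Q_CM^{test,±} Δ m_H m_G ↔ ∀ ξ, CMCharIdentityClausesTestSigned … ξ … (ξ.xiLocalChar ·)`).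
[cite: Rogawski1990, §13.1 Prop. 13.1.4 p. 199; §13.3 p. 202] -/
theorem cmCharIdentityPackageTestSigned_iff :
    CMCharIdentityPackageTestSigned L H hH hHd νH νG μω hμu Δ mH mG ↔
      ∀ ξ : OneDimAutRepH L, CMCharIdentityClausesTestSigned L H hH hHd Δ mH mG νH νG ξ μω hμu (fun v => ξ.xiLocalChar v) :=
  Iff.rfl

end Clauses

end Literature.NumberTheory.Rogawski1990

end
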